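import Literature.InformationTheory.QuantumCodes.SymplecticCodes
import HarnessLib

/-!
# There is no `[[13, 5, 4]]` quantum stabilizer code (Bierbrauer–Fears–Marcugini–Pambianco 2011) — named fact

J. Bierbrauer, R. Fears, S. Marcugini, F. Pambianco, *The nonexistence of a `[[13,5,4]]` quantum stabilizer
code*, IEEE Trans. Inform. Theory 57 (2011) 4788–4793 = arXiv:0908.1348 [BierbrauerEtAl2011] (held text
`paper:arxiv-0908.1348`), Theorem 1 (chunk p0003 L8–10):

> «Theorem 1. There is no `[[13,5,4]]`-quantum stabilizer code.»

Context (p0003 L3–5, L62–63): «After the determination of the parameter spectrum of additive quantum codes of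
distance 3 … the oldest open existence problem for quantum stabilizer codes concerns the parameters `[[13,5,4]]`
… The optimal parameters of quantum stabilizer codes of length `≤ 13` are known, with the sole exception of
parameters `[[13,5,4]]` (see the database in [Grassl])». Their Definition 4 of `[[n,m,d]]` (p0003 L50–56: a
quaternary quantum stabilizer code = additive code contained in its symplectic dual, binary dimension `n − m`,
«any codeword of `C⊥` having weight at most `d − 1` is in `C`»; `[[n,0,d]]`: self-dual of strength `d − 1`) is
exactly the tree's `IsAdditiveCode` / `AdditiveCodeExists` (`SymplecticCodes.lean`, CRSS Thm. 1 + the `k = 0`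
convention). The printed proof is a geometric reduction (systems of `13` code lines in `PG(7,2)`, Prop. 1: such a
code is pure; §3–4 case analysis) finished by a computer search (chunk p0009 L53–55: «The computer search showed
that there are no solutions»); it is NOT reproduced here — this file records the result as a NAMED FACT
(D-0014; LADDER-QEC tier: CITED, not certified), closing the cell `(n,k) = (13,5)` of CRSS 1998 Table III
(printed «3–4», arXiv:quant-ph/9608006v5 PDF p. 33) to `d = 3` in modern print; the lower value `[[13,5,3]]`
is a kernel certificate in the cell tree (`Summit.Ventures.QEC.Census.Additive…`, CRSS Table III calibration).

Net debt: `+1` named fact (no discharge attempted: the printed proof is a computer-assisted exhaustion).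
-/

namespace Literature.InformationTheory.QuantumCodes

/-- **Bierbrauer–Fears–Marcugini–Pambianco 2011, Theorem 1** (NAMED FACT, not proved here): «There is no
`[[13,5,4]]`-quantum stabilizer code.» In the tree's vocabulary: no self-orthogonal `S̄ ≤ Ē₁₃` of dimension
`8` has all vectors of `S̄⊥ ∖ S̄` of weight `≥ 4`.
[cite: BierbrauerEtAl2011, Thm. 1 (arXiv:0908.1348 chunk p0003 L8–10; IEEE Trans. IT 57 (2011) 4788)] -/
def BierbrauerEtAl2011_no_13_5_4 : Prop := ¬ AdditiveCodeExists 13 5 4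

/-- Monotone consequence: no `[[13, 5, d]]` stabilizer code for any `d ≥ 4` (so the CRSS Table III cell
`(13,5)`, printed «3–4», is `3`). [cite: BierbrauerEtAl2011, Thm. 1 (arXiv:0908.1348 chunk p0003 L8–10)] -/
theorem BierbrauerEtAl2011_no_13_5_4.of_le (h : BierbrauerEtAl2011_no_13_5_4) {d : ℕ} (hd : 4 ≤ d) :
    ¬ AdditiveCodeExists 13 5 d :=
  fun ⟨S, hS⟩ => h ⟨S, hS.mono hd⟩

end Literature.InformationTheory.QuantumCodes
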